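import Summits.AtomisticToContinuum.Crystallization.Theorems.HolmgrenBoyleLindLineVanishing
import Literature.Analysis.Complex.BlaschkeCondition

/-!
# Route `HolmgrenBoyleLind`: Lennard-Jones force fields of separated sources, part 5 —
transverse Blaschke: the field vanishes along thick normal rays
Support file for the crux item stmt-AtomisticToContinuum-6075 (`HalfSpaceUniqueContinuation`, line
`registered`: infrastructure for its unique-continuation cores `stub_ucRank0/1/2`, written by a
stub-worker of lead c1), continuing `HolmgrenBoyleLindLineVanishing.lean` (thin rectangles)
to the RIGHT HALF-PLANE. For a `δ`-separated source lying behind the pole margin of a ray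
`σ ↦ p + σ v` (`v` a unit vector, `⟪p − y, v⟫ ≥ d > 0` for all sources `y`; e.g. the inward normal
ray of a half-space containing the sources):

* `hbl_norm_lineQ_ge_of_re_nonneg`, `hbl_norm_lineH_le_of_re_nonneg` — POLE MARGIN: `Q_y(s)` has
  its zeros in `re s ≤ −d`, `|Q_y(s)| ≥ ‖p − y‖² d/(d + |s|)` on `re s ≥ 0`, and the complexified
  summand is `≤ ‖e‖ (1 + d⁻⁶) ((d + |s|)/d)⁸ ‖p − y‖⁻⁷` there;
* `hbl_lineSum_halfPlane` — the line sum is holomorphic on `re s > 0` and `O((d + |s|)⁸)`;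
* `hbl_inner_field_eq_zero_on_normal_ray` — **TRANSVERSE BLASCHKE**: a component `⟪e, Φ⟫` of the
  signed field vanishing at `p + tₙ v`, `tₙ ≥ 1` injective with `Σ 1/tₙ = ∞` (e.g. bounded gaps),
  vanishes on the whole open ray (Rudin Thm 15.23 via `eqOn_zero_of_re_pos_of_not_summable_inv`).
  Only the NORMAL direction works (oblique rays: a sector of opening `< π`, no conclusion).
All `[folklore]`; nothing here closes an item.
-/

noncomputable section
namespace Summit.AtomisticToContinuum.Crystallization.Theorems.HolmgrenBoyleLind

open scoped BigOperators Topology InnerProductSpace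
open Literature.MathematicalPhysics.StatisticalMechanics
open Summit.AtomisticToContinuum.Crystallization.Theorems

local notation "𝔼" => EuclideanSpace ℝ (Fin 3)

/-- Elementary: `max d (m - σ) ≥ m d / (d + σ)` for `d > 0`, `σ ≥ 0`. [folklore] -/
theorem hbl_mul_div_le_max {d m σ : ℝ} (hd : 0 < d) (hσ : 0 ≤ σ) :
    m * (d / (d + σ)) ≤ max d (m - σ) := by
  rw [show m * (d / (d + σ)) = m * d / (d + σ) by ring, div_le_iff₀ (by linarith : 0 < d + σ)]
  rcases le_or_gt m (d + σ) with h | h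
  · exact le_trans (by nlinarith) (mul_le_mul_of_nonneg_right (le_max_left _ _) (by linarith))
  · exact le_trans (by nlinarith) (mul_le_mul_of_nonneg_right (le_max_right _ _) (by linarith))

/-- **Pole margin.** For a unit direction `v` and `⟪w, v⟫ ≥ d > 0`, `Q(s) = ‖w‖² + 2s⟪w, v⟫ + s²`
factors as `(s + c - iβ)(s + c + iβ)`, `c = ⟪w, v⟫ ≥ d`, `c² + β² = ‖w‖²` (zeros in `re s ≤ -d`),
and `|Q(s)| ≥ ‖w‖² d / (d + |s|)` on the closed right half-plane. [folklore] -/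
theorem hbl_norm_lineQ_ge_of_re_nonneg {w v : 𝔼} {d : ℝ} (hv : ‖v‖ = 1) (hd : 0 < d)
    (hw : d ≤ ⟪w, v⟫_ℝ) {s : ℂ} (hs : 0 ≤ s.re) :
    ‖w‖ ^ 2 * (d / (d + ‖s‖)) ≤
      ‖((‖w‖ ^ 2 : ℝ) : ℂ) + 2 * s * ((⟪w, v⟫_ℝ : ℝ) : ℂ) + s ^ 2 * ((‖v‖ ^ 2 : ℝ) : ℂ)‖ := by
  set c : ℝ := ⟪w, v⟫_ℝ with hc
  have hcw : c ≤ ‖w‖ := by simpa [hv] using real_inner_le_norm w v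
  have hc0 : 0 < c := hd.trans_le hw
  have hw0 : 0 < ‖w‖ := hc0.trans_le hcw
  set β : ℝ := Real.sqrt (‖w‖ ^ 2 - c ^ 2) with hβ
  have hβ0 : 0 ≤ β := Real.sqrt_nonneg _
  have hβ2 : β ^ 2 = ‖w‖ ^ 2 - c ^ 2 := by
    rw [hβ, Real.sq_sqrt]
    nlinarith
  -- factorisation
  have hQ : ((‖w‖ ^ 2 : ℝ) : ℂ) + 2 * s * ((c : ℝ) : ℂ) + s ^ 2 * ((‖v‖ ^ 2 : ℝ) : ℂ) =
      (s + c - β * Complex.I) * (s + c + β * Complex.I) := by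
    rw [hv]
    have h2 : ((β : ℂ)) ^ 2 = ((‖w‖ ^ 2 - c ^ 2 : ℝ) : ℂ) := by exact_mod_cast hβ2
    push_cast at h2 ⊢
    linear_combination (-1 : ℂ) * h2 + ((β : ℂ) ^ 2) * Complex.I_sq
  -- the norms of `c ± iβ`
  have hn1 : ‖((c : ℝ) : ℂ) + β * Complex.I‖ = ‖w‖ := by
    rw [Complex.norm_add_mul_I, show c ^ 2 + β ^ 2 = ‖w‖ ^ 2 by rw [hβ2]; ring,
      Real.sqrt_sq hw0.le]
  have hn2 : ‖((c : ℝ) : ℂ) - β * Complex.I‖ = ‖w‖ := by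
    have e : ((c : ℝ) : ℂ) - β * Complex.I = ((c : ℝ) : ℂ) + ((-β : ℝ) : ℂ) * Complex.I := by
      push_cast; ring
    rw [e, Complex.norm_add_mul_I, show c ^ 2 + (-β) ^ 2 = ‖w‖ ^ 2 by rw [neg_sq, hβ2]; ring,
      Real.sqrt_sq hw0.le]
  -- real and imaginary parts of `c ± iβ`
  have hre1 : (((c : ℝ) : ℂ) + β * Complex.I).re = c := by simp
  have hre2 : (((c : ℝ) : ℂ) - β * Complex.I).re = c := by simp
  have him1 : (((c : ℝ) : ℂ) + β * Complex.I).im = β := by simp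
  have him2 : (((c : ℝ) : ℂ) - β * Complex.I).im = -β := by simp
  -- each factor is `≥ max d (‖w‖ - ‖s‖) ≥ ‖w‖ d / (d + ‖s‖)`
  have hfac : ∀ f : ℂ, ‖f‖ = ‖w‖ → f.re = c → ‖w‖ * (d / (d + ‖s‖)) ≤ ‖s + f‖ := by
    intro f hf hfre
    refine (hbl_mul_div_le_max hd (norm_nonneg s)).trans (max_le ?_ ?_)
    · refine le_trans ?_ (Complex.re_le_norm _)
      rw [Complex.add_re, hfre]
      linarith
    · have h := norm_sub_le (s + f) s
      rw [add_sub_cancel_left, hf] at h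
      linarith
  -- the factor on the side of `im s` has norm `≥ ‖w‖`
  have hbig : ∀ f : ℂ, f.re = c → f.im ^ 2 = β ^ 2 → 0 ≤ s.im * f.im → ‖w‖ ≤ ‖s + f‖ := by
    intro f hf1 hfi hf3
    have h1 : ‖w‖ ^ 2 ≤ ‖s + f‖ ^ 2 := by
      rw [Complex.sq_norm, Complex.normSq_apply, Complex.add_re, Complex.add_im, hf1]
      nlinarith [hβ2, hfi, sq_nonneg s.re, sq_nonneg s.im]
    exact (pow_le_pow_iff_left₀ (norm_nonneg _) (norm_nonneg _) two_ne_zero).1 h1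
  rw [hQ, norm_mul]
  rcases le_total 0 s.im with him | him
  · have h1 : ‖w‖ * (d / (d + ‖s‖)) ≤ ‖s + ↑c - ↑β * Complex.I‖ := by
      have h := hfac _ hn2 hre2
      rwa [← add_sub_assoc] at h
    have h2 : ‖w‖ ≤ ‖s + ↑c + ↑β * Complex.I‖ := by
      have h := hbig (((c : ℝ) : ℂ) + β * Complex.I) hre1 (by rw [him1])
        (by rw [him1]; exact mul_nonneg him hβ0)
      rwa [← add_assoc] at h
    calc ‖w‖ ^ 2 * (d / (d + ‖s‖)) = ‖w‖ * (d / (d + ‖s‖)) * ‖w‖ := by ring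
      _ ≤ _ := mul_le_mul h1 h2 (norm_nonneg _) (norm_nonneg _)
  · have h1 : ‖w‖ * (d / (d + ‖s‖)) ≤ ‖s + ↑c + ↑β * Complex.I‖ := by
      have h := hfac _ hn1 hre1
      rwa [← add_assoc] at h
    have h2 : ‖w‖ ≤ ‖s + ↑c - ↑β * Complex.I‖ := by
      have h := hbig (((c : ℝ) : ℂ) - β * Complex.I) hre2 (by rw [him2, neg_sq])
        (by rw [him2]; nlinarith)
      rwa [← add_sub_assoc] at h
    calc ‖w‖ ^ 2 * (d / (d + ‖s‖)) = ‖w‖ * (‖w‖ * (d / (d + ‖s‖))) := by ring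
      _ ≤ _ := mul_le_mul h2 h1 (by positivity) (norm_nonneg _)

/-- **Majorant on the right half-plane.** Under the pole margin `⟪w, v⟫ ≥ d > 0` (`v` unit) the
complexified summand `H(s) = (Q(s)⁻⁴ − Q(s)⁻⁷)(⟪e, w⟫ + s ⟪e, v⟫)` obeys, for `re s ≥ 0`,
`|H(s)| ≤ ‖e‖ (1 + d⁻⁶) ((d + |s|)/d)⁸ ‖w‖⁻⁷` (polynomial growth × summable weight). [folklore] -/
theorem hbl_norm_lineH_le_of_re_nonneg {w v e : 𝔼} {d : ℝ} (hv : ‖v‖ = 1) (hd : 0 < d)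
    (hw : d ≤ ⟪w, v⟫_ℝ) {s : ℂ} (hs : 0 ≤ s.re) :
    ‖(((((‖w‖ ^ 2 : ℝ) : ℂ) + 2 * s * ((⟪w, v⟫_ℝ : ℝ) : ℂ) + s ^ 2 * ((‖v‖ ^ 2 : ℝ) : ℂ)) ^ 4)⁻¹ -
        ((((‖w‖ ^ 2 : ℝ) : ℂ) + 2 * s * ((⟪w, v⟫_ℝ : ℝ) : ℂ) + s ^ 2 * ((‖v‖ ^ 2 : ℝ) : ℂ)) ^ 7)⁻¹) *
      (((⟪e, w⟫_ℝ : ℝ) : ℂ) + s * ((⟪e, v⟫_ℝ : ℝ) : ℂ))‖ ≤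
      ‖e‖ * (1 + (d⁻¹) ^ 6) * ((d + ‖s‖) / d) ^ 8 * (‖w‖⁻¹) ^ 7 := by
  set Q : ℂ := ((‖w‖ ^ 2 : ℝ) : ℂ) + 2 * s * ((⟪w, v⟫_ℝ : ℝ) : ℂ) + s ^ 2 * ((‖v‖ ^ 2 : ℝ) : ℂ)
    with hQdef
  set m : ℝ := ‖w‖ with hm
  set k : ℝ := (d + ‖s‖) / d with hk
  have hcw : ⟪w, v⟫_ℝ ≤ m := by simpa [hv] using real_inner_le_norm w v
  have hdm : d ≤ m := hw.trans hcw
  have hm0 : 0 < m := hd.trans_le hdm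
  have hk1 : 1 ≤ k := by rw [hk, le_div_iff₀ hd]; linarith [norm_nonneg s]
  have hk0 : 0 < k := one_pos.trans_le hk1
  have hQ : m ^ 2 / k ≤ ‖Q‖ := by
    have h := hbl_norm_lineQ_ge_of_re_nonneg hv hd hw hs
    have e : m ^ 2 / k = ‖w‖ ^ 2 * (d / (d + ‖s‖)) := by
      rw [hk, hm]
      field_simp
    rwa [e]
  have hQpos : 0 < ‖Q‖ := lt_of_lt_of_le (by positivity) hQ
  -- the inverse powers of `Q`
  set q : ℝ := k * (m⁻¹) ^ 2 with hq
  have hQinv : ‖Q‖⁻¹ ≤ q := by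
    have h1 : ‖Q‖⁻¹ ≤ (m ^ 2 / k)⁻¹ := (inv_le_inv₀ hQpos (by positivity)).2 hQ
    have h2 : (m ^ 2 / k)⁻¹ = q := by rw [hq]; field_simp
    rwa [h2] at h1
  have hQi0 : 0 ≤ ‖Q‖⁻¹ := inv_nonneg.2 hQpos.le
  have hK : ‖(Q ^ 4)⁻¹ - (Q ^ 7)⁻¹‖ ≤ q ^ 4 + q ^ 7 := by
    refine (norm_sub_le _ _).trans ?_
    rw [norm_inv, norm_inv, norm_pow, norm_pow, ← inv_pow, ← inv_pow]
    exact add_le_add (pow_le_pow_left₀ hQi0 hQinv 4) (pow_le_pow_left₀ hQi0 hQinv 7)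
  -- the numerator
  have hN : ‖((⟪e, w⟫_ℝ : ℝ) : ℂ) + s * ((⟪e, v⟫_ℝ : ℝ) : ℂ)‖ ≤ ‖e‖ * (m * k) := by
    have h1 : ‖((⟪e, w⟫_ℝ : ℝ) : ℂ)‖ ≤ ‖e‖ * m := by
      rw [Complex.norm_real, Real.norm_eq_abs]
      exact abs_real_inner_le_norm e w
    have h2 : ‖s * ((⟪e, v⟫_ℝ : ℝ) : ℂ)‖ ≤ ‖s‖ * ‖e‖ := by
      rw [norm_mul, Complex.norm_real, Real.norm_eq_abs]
      refine mul_le_mul_of_nonneg_left ?_ (norm_nonneg _)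
      simpa [hv] using abs_real_inner_le_norm e v
    have h3 : m + ‖s‖ ≤ m * k := by
      rw [hk, mul_div_assoc', le_div_iff₀ hd]
      nlinarith [norm_nonneg s]
    calc ‖((⟪e, w⟫_ℝ : ℝ) : ℂ) + s * ((⟪e, v⟫_ℝ : ℝ) : ℂ)‖
        ≤ ‖e‖ * m + ‖s‖ * ‖e‖ := (norm_add_le _ _).trans (add_le_add h1 h2)
      _ = ‖e‖ * (m + ‖s‖) := by ring
      _ ≤ ‖e‖ * (m * k) := mul_le_mul_of_nonneg_left h3 (norm_nonneg _)
  -- assemble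
  rw [norm_mul]
  have hmm : m⁻¹ * m = 1 := inv_mul_cancel₀ hm0.ne'
  have hmi0 : 0 ≤ m⁻¹ := inv_nonneg.2 hm0.le
  calc ‖(Q ^ 4)⁻¹ - (Q ^ 7)⁻¹‖ * ‖((⟪e, w⟫_ℝ : ℝ) : ℂ) + s * ((⟪e, v⟫_ℝ : ℝ) : ℂ)‖
      ≤ (q ^ 4 + q ^ 7) * (‖e‖ * (m * k)) :=
        mul_le_mul hK hN (norm_nonneg _) (by positivity)
    _ = ‖e‖ * (k ^ 5 * (m⁻¹) ^ 7 + k ^ 8 * ((m⁻¹) ^ 6 * (m⁻¹) ^ 7)) := by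
        rw [hq]
        linear_combination (‖e‖ * (k ^ 5 * (m⁻¹) ^ 7 + k ^ 8 * (m⁻¹) ^ 13)) * hmm
    _ ≤ ‖e‖ * (k ^ 8 * (m⁻¹) ^ 7 + k ^ 8 * ((d⁻¹) ^ 6 * (m⁻¹) ^ 7)) := by
        have h5 : k ^ 5 ≤ k ^ 8 := pow_le_pow_right₀ hk1 (by norm_num)
        have h6 : (m⁻¹) ^ 6 ≤ (d⁻¹) ^ 6 := pow_le_pow_left₀ hmi0 ((inv_le_inv₀ hm0 hd).2 hdm) 6
        have h7 : 0 ≤ (m⁻¹) ^ 7 := by positivity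
        have h8 : 0 ≤ k ^ 8 := by positivity
        refine mul_le_mul_of_nonneg_left (add_le_add ?_ ?_) (norm_nonneg _)
        · exact mul_le_mul_of_nonneg_right h5 h7
        · exact mul_le_mul_of_nonneg_left (mul_le_mul_of_nonneg_right h6 h7) h8
    _ = ‖e‖ * (1 + (d⁻¹) ^ 6) * k ^ 8 * (m⁻¹) ^ 7 := by ring

/-- Clearance along the ray: under the pole margin, the real points `p + σ v`, `σ ≥ 0`, are at
distance `≥ d` from the source. [folklore] -/
theorem hbl_clear_of_pole_margin {X : Set 𝔼} {d : ℝ} {p v : 𝔼} (hv : ‖v‖ = 1)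
    (hcl : ∀ y ∈ X, d ≤ ⟪p - y, v⟫_ℝ) {σ : ℝ} (hσ : 0 ≤ σ) :
    ∀ y ∈ X, d ≤ ‖p + σ • v - y‖ := by
  intro y hy
  have h1 : ⟪p + σ • v - y, v⟫_ℝ = ⟪p - y, v⟫_ℝ + σ := by
    rw [show p + σ • v - y = (p - y) + σ • v by abel, inner_add_left, real_inner_smul_left,
      real_inner_self_eq_norm_sq, hv]
    ring
  have h2 : ⟪p + σ • v - y, v⟫_ℝ ≤ ‖p + σ • v - y‖ := by
    simpa [hv] using real_inner_le_norm (p + σ • v - y) v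
  linarith [hcl y hy]

/-- **The line sum on the right half-plane.** Over a `δ`-separated source behind the pole margin
`⟪p − y, v⟫ ≥ d > 0` (`v` a unit vector) the complexified line sum `Σ'_{y ∈ X} H_y` is holomorphic
on `re s > 0` (`Complex.differentiableOn_tsum_of_summable_norm` on the pieces `|s| < R`) and
bounded by `B ((d + |s|)/d)⁸` (packing majorant `hbl_summable_inv_pow_seven`). [folklore] -/
theorem hbl_lineSum_halfPlane {X : Set 𝔼} {δ d : ℝ} (hδ : 0 < δ) (hd : 0 < d)
    (hsep : ∀ a ∈ X, ∀ b ∈ X, a ≠ b → δ ≤ dist a b) (p v e : 𝔼) (hv : ‖v‖ = 1)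
    (hcl : ∀ y ∈ X, d ≤ ⟪p - y, v⟫_ℝ) :
    DifferentiableOn ℂ (fun s : ℂ => ∑' y : X,
      (((((‖p - y‖ ^ 2 : ℝ) : ℂ) + 2 * s * ((⟪p - y, v⟫_ℝ : ℝ) : ℂ) + s ^ 2 * ((‖v‖ ^ 2 : ℝ) : ℂ)) ^ 4)⁻¹ -
        ((((‖p - y‖ ^ 2 : ℝ) : ℂ) + 2 * s * ((⟪p - y, v⟫_ℝ : ℝ) : ℂ) + s ^ 2 * ((‖v‖ ^ 2 : ℝ) : ℂ)) ^ 7)⁻¹) *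
      (((⟪e, p - y⟫_ℝ : ℝ) : ℂ) + s * ((⟪e, v⟫_ℝ : ℝ) : ℂ))) {s : ℂ | 0 < s.re} ∧
    ∃ B : ℝ, 0 ≤ B ∧ ∀ s : ℂ, 0 ≤ s.re → ‖∑' y : X,
      (((((‖p - y‖ ^ 2 : ℝ) : ℂ) + 2 * s * ((⟪p - y, v⟫_ℝ : ℝ) : ℂ) + s ^ 2 * ((‖v‖ ^ 2 : ℝ) : ℂ)) ^ 4)⁻¹ -
        ((((‖p - y‖ ^ 2 : ℝ) : ℂ) + 2 * s * ((⟪p - y, v⟫_ℝ : ℝ) : ℂ) + s ^ 2 * ((‖v‖ ^ 2 : ℝ) : ℂ)) ^ 7)⁻¹) *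
      (((⟪e, p - y⟫_ℝ : ℝ) : ℂ) + s * ((⟪e, v⟫_ℝ : ℝ) : ℂ))‖ ≤ B * ((d + ‖s‖) / d) ^ 8 := by
  -- the packing weight dominates `‖p - y‖⁻⁷`
  have hwt : ∀ y ∈ X, (‖p - y‖⁻¹) ^ 7 ≤ ((max (d / 2) (dist y p / 2 - 0))⁻¹) ^ 7 := by
    intro y hy
    have hm : d ≤ ‖p - y‖ := by simpa using hbl_clear_of_pole_margin hv hcl le_rfl y hy
    have hm0 : 0 < ‖p - y‖ := hd.trans_le hm
    have hdist : dist y p = ‖p - y‖ := by rw [dist_comm, dist_eq_norm]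
    have hmax : max (d / 2) (dist y p / 2 - 0) ≤ ‖p - y‖ := by
      rw [hdist, sub_zero]
      exact max_le (by linarith) (by linarith)
    exact pow_le_pow_left₀ (inv_nonneg.2 hm0.le)
      ((inv_le_inv₀ hm0 (lt_of_lt_of_le (by linarith) (le_max_left _ _))).2 hmax) 7
  -- pointwise bound on `re s ≥ 0`
  have hpt : ∀ (y : X) (s : ℂ), 0 ≤ s.re →
      ‖(((((‖p - y‖ ^ 2 : ℝ) : ℂ) + 2 * s * ((⟪p - y, v⟫_ℝ : ℝ) : ℂ) + s ^ 2 * ((‖v‖ ^ 2 : ℝ) : ℂ)) ^ 4)⁻¹ -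
        ((((‖p - y‖ ^ 2 : ℝ) : ℂ) + 2 * s * ((⟪p - y, v⟫_ℝ : ℝ) : ℂ) + s ^ 2 * ((‖v‖ ^ 2 : ℝ) : ℂ)) ^ 7)⁻¹) *
      (((⟪e, p - y⟫_ℝ : ℝ) : ℂ) + s * ((⟪e, v⟫_ℝ : ℝ) : ℂ))‖ ≤
      ‖e‖ * (1 + (d⁻¹) ^ 6) * ((d + ‖s‖) / d) ^ 8 * ((max (d / 2) (dist (y : 𝔼) p / 2 - 0))⁻¹) ^ 7 := by
    intro y s hs
    refine (hbl_norm_lineH_le_of_re_nonneg hv hd (hcl y y.2) hs).trans ?_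
    exact mul_le_mul_of_nonneg_left (hwt y y.2) (by positivity)
  have hsum : ∀ C : ℝ, 0 ≤ C → Summable (fun y : X => C * ((max (d / 2) (dist (y : 𝔼) p / 2 - 0))⁻¹) ^ 7) :=
    fun C hC => hbl_summable_inv_pow_seven 0 hδ (half_pos hd) hsep (fun y : X => (y : 𝔼))
      Subtype.val_injective (fun y => y.2) p hC
  refine ⟨?_, ?_⟩
  · -- holomorphy, on the bounded pieces
    intro s₀ hs₀
    set R : ℝ := ‖s₀‖ + 1 with hR
    set U : Set ℂ := {s : ℂ | 0 < s.re} ∩ {s : ℂ | ‖s‖ < R} with hU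
    have hUo : IsOpen U :=
      (isOpen_lt continuous_const Complex.continuous_re).inter (isOpen_lt continuous_norm continuous_const)
    have hs₀U : s₀ ∈ U := ⟨hs₀, by show ‖s₀‖ < R; rw [hR]; linarith⟩
    refine (DifferentiableOn.differentiableAt ?_ (hUo.mem_nhds hs₀U)).differentiableWithinAt
    refine Complex.differentiableOn_tsum_of_summable_norm
      (hsum (‖e‖ * (1 + (d⁻¹) ^ 6) * ((d + R) / d) ^ 8) (by positivity)) (fun y => ?_) hUo
      (fun y s hs => ?_)
    · intro s hs
      refine (hbl_differentiableAt_lineH (p - y) v e ?_).differentiableWithinAt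
      have hQ := hbl_norm_lineQ_ge_of_re_nonneg hv hd (hcl y y.2) hs.1.le
      have hm : 0 < ‖p - (y : 𝔼)‖ :=
        hd.trans_le (by simpa using hbl_clear_of_pole_margin hv hcl le_rfl y y.2)
      have hpos : 0 < ‖p - (y : 𝔼)‖ ^ 2 * (d / (d + ‖s‖)) := by positivity
      exact norm_pos_iff.1 (hpos.trans_le hQ)
    · refine (hpt y s hs.1.le).trans ?_
      have hk : ((d + ‖s‖) / d) ^ 8 ≤ ((d + R) / d) ^ 8 := by
        refine pow_le_pow_left₀ (by positivity) ?_ 8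
        exact div_le_div_of_nonneg_right (by linarith [show ‖s‖ < R from hs.2]) hd.le
      have hw0 : 0 ≤ ((max (d / 2) (dist (y : 𝔼) p / 2 - 0))⁻¹) ^ 7 :=
        pow_nonneg (inv_nonneg.2 ((half_pos hd).le.trans (le_max_left _ _))) 7
      exact mul_le_mul_of_nonneg_right (mul_le_mul_of_nonneg_left hk (by positivity)) hw0
  · -- the bound
    obtain ⟨B, hB0, hB⟩ := hbl_exists_sum_inv_pow_seven_le 0 hδ (half_pos hd)
    refine ⟨‖e‖ * (1 + (d⁻¹) ^ 6) * B, by positivity, fun s hs => ?_⟩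
    have hs1 := hsum (‖e‖ * (1 + (d⁻¹) ^ 6) * ((d + ‖s‖) / d) ^ 8) (by positivity)
    have hs2 := Summable.of_nonneg_of_le (fun _ => norm_nonneg _) (fun y => hpt y s hs) hs1
    refine (norm_tsum_le_tsum_norm hs2).trans ((hs2.tsum_le_tsum (fun y => hpt y s hs) hs1).trans ?_)
    rw [tsum_mul_left]
    have hts : ∑' y : X, ((max (d / 2) (dist (y : 𝔼) p / 2 - 0))⁻¹) ^ 7 ≤ B := by
      have hs3 : Summable (fun y : X => ((max (d / 2) (dist (y : 𝔼) p / 2 - 0))⁻¹) ^ 7) := by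
        simpa only [one_mul] using hsum 1 zero_le_one
      refine hs3.tsum_le_of_sum_le fun F => ?_
      have h := hB (F.map ⟨fun y : X => (y : 𝔼), Subtype.val_injective⟩) p ?_
      · rwa [Finset.sum_map] at h
      · intro a ha b hb hab
        simp only [Finset.mem_map, Function.Embedding.coeFn_mk] at ha hb
        obtain ⟨i, -, rfl⟩ := ha
        obtain ⟨j, -, rfl⟩ := hb
        exact hsep _ i.2 _ j.2 hab
    calc ‖e‖ * (1 + (d⁻¹) ^ 6) * ((d + ‖s‖) / d) ^ 8 *
          ∑' y : X, ((max (d / 2) (dist (y : 𝔼) p / 2 - 0))⁻¹) ^ 7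
        ≤ ‖e‖ * (1 + (d⁻¹) ^ 6) * ((d + ‖s‖) / d) ^ 8 * B :=
          mul_le_mul_of_nonneg_left hts (by positivity)
      _ = ‖e‖ * (1 + (d⁻¹) ^ 6) * B * ((d + ‖s‖) / d) ^ 8 := by ring

/-- On the closed right half-plane, `‖d + s‖ ≥ (d + ‖s‖)/2` (`d ≥ 0`). [folklore] -/
theorem hbl_norm_add_ge_half {d : ℝ} (hd : 0 ≤ d) {s : ℂ} (hs : 0 ≤ s.re) :
    (d + ‖s‖) / 2 ≤ ‖(d : ℂ) + s‖ := by
  have h1 : |((d : ℂ) + s).re| ≤ ‖(d : ℂ) + s‖ := Complex.abs_re_le_norm _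
  have h2 : |((d : ℂ) + s).im| ≤ ‖(d : ℂ) + s‖ := Complex.abs_im_le_norm _
  have h3 : ‖s‖ ≤ |s.re| + |s.im| := Complex.norm_le_abs_re_add_abs_im s
  simp only [Complex.add_re, Complex.ofReal_re, Complex.add_im, Complex.ofReal_im, zero_add] at h1 h2
  rw [abs_of_nonneg (by linarith)] at h1
  linarith [abs_of_nonneg hs]

/-- **Transverse Blaschke: the field vanishes along thick normal rays.** Let `X⁺, X⁻ ⊂ ℝ³` be
`δ`-separated, behind the pole margin of the ray `σ ↦ p + σ v` (`v` unit, `⟪p − y, v⟫ ≥ d > 0`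
for every source `y`; e.g. `v = −u/‖u‖` for sources in `{⟪z, u⟫ ≥ a}`, `⟪p, u⟫ < a`). If a
component `⟪e, Φ⟫` of the signed force field vanishes at `p + tₙ v` for an injective real sequence
`tₙ ≥ 1` with `Σ 1/tₙ = ∞` (e.g. bounded gaps), it vanishes on the whole open ray `σ > 0`:
`(d + s)⁻⁹ · (line sum)` is bounded holomorphic on `re s > 0` (`hbl_lineSum_halfPlane`) with a
non-Blaschke sequence of real zeros (`eqOn_zero_of_re_pos_of_not_summable_inv`, Rudin 15.23).
For OBLIQUE rays the holomorphy domain is only a sector of opening `< π`: no conclusion. [folklore] -/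
theorem hbl_inner_field_eq_zero_on_normal_ray :
    ∀ (Xp Xm : Set (EuclideanSpace ℝ (Fin 3))) (δ d : ℝ), 0 < δ → 0 < d →
      (∀ a ∈ Xp, ∀ b ∈ Xp, a ≠ b → δ ≤ dist a b) →
      (∀ a ∈ Xm, ∀ b ∈ Xm, a ≠ b → δ ≤ dist a b) →
      ∀ (p v e : EuclideanSpace ℝ (Fin 3)), ‖v‖ = 1 →
      (∀ y ∈ Xp, d ≤ inner ℝ (p - y) v) → (∀ y ∈ Xm, d ≤ inner ℝ (p - y) v) →
      ∀ (t : ℕ → ℝ), (∀ n : ℕ, 1 ≤ t n) → Function.Injective t →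
      ¬ Summable (fun n : ℕ => (t n)⁻¹) →
      (∀ n : ℕ, inner ℝ e
        ((∑' y : Xp, (deriv lennardJones (dist (p + t n • v) y) / dist (p + t n • v) y) •
            (p + t n • v - (y : EuclideanSpace ℝ (Fin 3)))) -
          (∑' y : Xm, (deriv lennardJones (dist (p + t n • v) y) / dist (p + t n • v) y) •
            (p + t n • v - (y : EuclideanSpace ℝ (Fin 3))))) = 0) →
      ∀ σ : ℝ, 0 < σ → inner ℝ e
        ((∑' y : Xp, (deriv lennardJones (dist (p + σ • v) y) / dist (p + σ • v) y) •
            (p + σ • v - (y : EuclideanSpace ℝ (Fin 3)))) -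
          (∑' y : Xm, (deriv lennardJones (dist (p + σ • v) y) / dist (p + σ • v) y) •
            (p + σ • v - (y : EuclideanSpace ℝ (Fin 3))))) = 0 := by
  intro Xp Xm δ d hδ hd hsepp hsepm p v e hv hclp hclm t ht hinj hsum hzero
  -- the complexified line sums
  set Gp : ℂ → ℂ := fun s : ℂ => ∑' y : Xp,
      (((((‖p - y‖ ^ 2 : ℝ) : ℂ) + 2 * s * ((⟪p - y, v⟫_ℝ : ℝ) : ℂ) + s ^ 2 * ((‖v‖ ^ 2 : ℝ) : ℂ)) ^ 4)⁻¹ -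
        ((((‖p - y‖ ^ 2 : ℝ) : ℂ) + 2 * s * ((⟪p - y, v⟫_ℝ : ℝ) : ℂ) + s ^ 2 * ((‖v‖ ^ 2 : ℝ) : ℂ)) ^ 7)⁻¹) *
      (((⟪e, p - y⟫_ℝ : ℝ) : ℂ) + s * ((⟪e, v⟫_ℝ : ℝ) : ℂ)) with hGp
  set Gm : ℂ → ℂ := fun s : ℂ => ∑' y : Xm,
      (((((‖p - y‖ ^ 2 : ℝ) : ℂ) + 2 * s * ((⟪p - y, v⟫_ℝ : ℝ) : ℂ) + s ^ 2 * ((‖v‖ ^ 2 : ℝ) : ℂ)) ^ 4)⁻¹ -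
        ((((‖p - y‖ ^ 2 : ℝ) : ℂ) + 2 * s * ((⟪p - y, v⟫_ℝ : ℝ) : ℂ) + s ^ 2 * ((‖v‖ ^ 2 : ℝ) : ℂ)) ^ 7)⁻¹) *
      (((⟪e, p - y⟫_ℝ : ℝ) : ℂ) + s * ((⟪e, v⟫_ℝ : ℝ) : ℂ)) with hGm
  obtain ⟨hdp, Bp, hBp0, hBp⟩ := hbl_lineSum_halfPlane hδ hd hsepp p v e hv hclp
  obtain ⟨hdm, Bm, hBm0, hBm⟩ := hbl_lineSum_halfPlane hδ hd hsepm p v e hv hclm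
  -- values on the nonnegative real axis
  have hreal : ∀ σ : ℝ, 0 ≤ σ → Gp σ - Gm σ =
      ((⟪e, (∑' y : Xp, (deriv lennardJones (dist (p + σ • v) y) / dist (p + σ • v) y) •
          (p + σ • v - (y : 𝔼))) -
        (∑' y : Xm, (deriv lennardJones (dist (p + σ • v) y) / dist (p + σ • v) y) •
          (p + σ • v - (y : 𝔼)))⟫_ℝ : ℝ) : ℂ) := by
    intro σ hσ
    simp only [hGp, hGm]
    rw [inner_sub_right, Complex.ofReal_sub,
      hbl_lineSum_ofReal hδ hd hsepp p v e (hbl_clear_of_pole_margin hv hclp hσ),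
      hbl_lineSum_ofReal hδ hd hsepm p v e (hbl_clear_of_pole_margin hv hclm hσ)]
  -- the damped function `(d + s)⁻⁹ (Gp − Gm)`
  set G : ℂ → ℂ := fun s => (Gp s - Gm s) * (((d : ℂ) + s) ^ 9)⁻¹ with hG
  have hds : ∀ s : ℂ, 0 < s.re → ((d : ℂ) + s) ≠ 0 := by
    intro s hs h0
    have h := congrArg Complex.re h0
    simp only [Complex.add_re, Complex.ofReal_re, Complex.zero_re] at h
    linarith
  have hGd : DifferentiableOn ℂ G {s : ℂ | 0 < s.re} := by
    refine (hdp.sub hdm).mul (DifferentiableOn.inv ?_ (fun s hs => pow_ne_zero 9 (hds s hs)))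
    fun_prop
  have hGb : ∃ M : ℝ, ∀ s : ℂ, 0 < s.re → ‖G s‖ ≤ M := by
    refine ⟨(Bp + Bm) * 2 ^ 9 / d ^ 9, fun s hs => ?_⟩
    have h1 : ‖Gp s - Gm s‖ ≤ (Bp + Bm) * ((d + ‖s‖) / d) ^ 8 := by
      calc ‖Gp s - Gm s‖ ≤ ‖Gp s‖ + ‖Gm s‖ := norm_sub_le _ _
        _ ≤ Bp * ((d + ‖s‖) / d) ^ 8 + Bm * ((d + ‖s‖) / d) ^ 8 :=
          add_le_add (hBp s hs.le) (hBm s hs.le)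
        _ = (Bp + Bm) * ((d + ‖s‖) / d) ^ 8 := by ring
    have h2 : (d + ‖s‖) / 2 ≤ ‖(d : ℂ) + s‖ := hbl_norm_add_ge_half hd.le hs.le
    have hds0 : 0 < d + ‖s‖ := by positivity
    have h3 : ‖(((d : ℂ) + s) ^ 9)⁻¹‖ ≤ (2 / (d + ‖s‖)) ^ 9 := by
      rw [norm_inv, norm_pow, ← inv_pow]
      refine pow_le_pow_left₀ (inv_nonneg.2 (norm_nonneg _)) ?_ 9
      rw [show (2 : ℝ) / (d + ‖s‖) = ((d + ‖s‖) / 2)⁻¹ by rw [inv_div]]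
      exact (inv_le_inv₀ (lt_of_lt_of_le (by positivity) h2) (by positivity)).2 h2
    have h4 : d / (d + ‖s‖) ≤ 1 := div_le_one_of_le₀ (by linarith [norm_nonneg s]) hds0.le
    calc ‖(Gp s - Gm s) * (((d : ℂ) + s) ^ 9)⁻¹‖
        = ‖Gp s - Gm s‖ * ‖(((d : ℂ) + s) ^ 9)⁻¹‖ := norm_mul _ _
      _ ≤ (Bp + Bm) * ((d + ‖s‖) / d) ^ 8 * (2 / (d + ‖s‖)) ^ 9 :=
          mul_le_mul h1 h3 (norm_nonneg _) (by positivity)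
      _ = (Bp + Bm) * 2 ^ 9 / d ^ 9 * (d / (d + ‖s‖)) := by
          field_simp
      _ ≤ (Bp + Bm) * 2 ^ 9 / d ^ 9 * 1 := mul_le_mul_of_nonneg_left h4 (by positivity)
      _ = (Bp + Bm) * 2 ^ 9 / d ^ 9 := mul_one _
  -- the zeros
  have hGz : ∀ n, G (t n) = 0 := by
    intro n
    show (Gp (t n) - Gm (t n)) * (((d : ℂ) + (t n)) ^ 9)⁻¹ = 0
    rw [hreal (t n) (by linarith [ht n]), hzero n, Complex.ofReal_zero, zero_mul]
  have hG0 := Literature.Analysis.Complex.eqOn_zero_of_re_pos_of_not_summable_inv hGd hGb ht hinj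
    hGz hsum
  intro σ hσ
  have hσmem : ((σ : ℝ) : ℂ) ∈ {s : ℂ | 0 < s.re} := by simpa using hσ
  have h' : (Gp σ - Gm σ) * (((d : ℂ) + σ) ^ 9)⁻¹ = 0 := hG0 hσmem
  rcases mul_eq_zero.1 h' with h1 | h1
  · rwa [hreal σ hσ.le, Complex.ofReal_eq_zero] at h1
  · exact absurd (inv_eq_zero.1 h1) (pow_ne_zero 9 (hds _ hσmem))

end Summit.AtomisticToContinuum.Crystallization.Theorems.HolmgrenBoyleLind

end
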